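import Mathlib
import HarnessLib
import HarnessLib.Audit
import Summits.HubbardSuperconductivity.Statement
import Literature.MathematicalPhysics.QuantumLattice.FermionQuasiFree
import Literature.Barriers.HubbardSuperconductivity.PureModelStripeCompetition
import HarnessLib.Audit.Status.Attr

/-!
Route: SpinStructureRigidity

DORMANT since 2026-08-22T22:26:33Z (reconciler: no traction for 5.7 d (last activity item-evidence-added at 2026-08-17T04:38:37Z); parked, not closed — `ledger route dormant route-HubbardSuperconductivity-SpinStructureRigidity --off` to) — unstaffed, not closed; items shared with open routes are served there. `ledger route dormant <id> --off` reactivates.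

Route SpinStructureRigidity — HubbardSuperconductivity/HubbardSuperconductivity (plancard; realises
idea card spin-structure-rigidity-beta-kappa-l, novelty audit: new-combination).

THESIS X (it suffices to show) = RIGIDITY ∧ BRIDGE ∧ DESCENT, read in the isotropic scaling regime β
= κL of the PURE model:
put hubbardTorus 2 L 1 U on the space-time 3-torus with fermionic boundary data (θ, τ):
Aharonov–Bohm fluxes θ = (θ₁, θ₂) through the two spatial cycles (uniform Peierls gauge e^{iθ_i/L}
on every bond of direction i; θ_i = π is the antiperiodic spatial spin structure) and the temporal
structure τ ∈ {AP, P} (P = insertion of the fermion parity (−1)^N̂, `parityOp`), grand-canonically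
at chemical potential μ: Z_L(κ; θ, AP) = Re tr e^{−κL·H_L(θ;U,μ)} (`Matrix.partitionFn`), Z_L(κ; θ,
P) = Re tr[(−1)^N̂ e^{−κL·H_L(θ;U,μ)}], H_L(θ;U,μ) = dGamma(T_L(θ,μ)) + hubbardTorus 2 L 0 U (all
existing decls; T_L written inline with Matrix.of).
(RIGIDITY, SsrRigidity, rank 2) ∃ U > 0, μ, a density n ∈ (3/5, 1) and κ₀ > 0 such that the Gibbs
density at (μ, β = κL) tends to n for every κ ≥ κ₀ and, for every κ ≥ κ₀ and ε > 0, eventually in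
even L: (R1) e^{−C} ≤ Z(θ,AP)/Z(0,AP) ≤ e^{C} on the pair-invisible fluxes θ ∈ {0,π}² (h/2e flux
quantisation in free-energy form), (R2) Z(θ,AP) ≤ e^{−cL} Z(0,AP) whenever some θ_i is ε-far from πℤ
(the twist costs κ·ρ_s·ε²·L: charge-2e stiffness), (T) Σ_{θ∈{0,π}²} |Z(θ,P)| ≥ e^{−C} Z(0,AP)
(temporal rigidity of the pair-invisible ORBIT: no Fermi surface; a Fermi-surface metal has every
|Z(θ,P)| ≤ e^{−c'L/κ} Z(θ,AP) — support item SsrFreeParityCollapse, provable now).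
(BRIDGE, SsrBridge, rank 3; the named conditional step) for U > 0 and density n ∈ (3/5,1) the flux
half (R1)+(R2) forces d_{x²−y²} pair-field long-range order ⟨Δ_d†Δ_d⟩_{κL,μ} ≥ cL⁴ of the Gibbs
state of hubbardTorusWith 2 L 1 U μ at β = κL, all κ ≥ κ₀.
(DESCENT, SsrThermalToGround, rank 4) thermal d-wave LRO at β = κL for all κ ≥ κ₀, plus the density
clause, gives the summit's matrix HasDWavePairFieldLROAt U (1 − n) (every (N_L, S^z=0)-sector ground
state, N_L = 2⌊nL²/2⌋, L even).
Assembly (pure logic, proved rc0 in the planner's Sketch.lean): SsrRigidity → SsrBridge →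
SsrThermalToGround → HubbardSuperconductivity, with δ := 1 − n ∈ (0, 2/5) ⊂ (0, 1/2).
One-line Lean form of X: `SsrRigidity ∧ SsrBridge ∧ SsrThermalToGround` (the three decls of this
file; every constant exists: Literature.MathematicalPhysics.QuantumLattice.dGamma / hubbardTorus /
hubbardTorusWith / parityOp / totalNumber / pairField / dWaveFormFactor / Orb / FermionTorus,
Matrix.partitionFn / gibbsWeight / gibbsState,
Literature.Barriers.HubbardSuperconductivity.HasDWavePairFieldLROAt).

TWO-LAYER PLAN (D-0019). Layer 1 = the three ranked cruxes + the calibration support. Layer 2 (at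
the first split, planner-owned): SsrRigidity ↦ {SsrFluxRigidity (R1)+(R2), SsrParityOrbitRigidity
(T)} glued by ∧; SsrThermalToGround ↦ {ensemble equivalence GC(μ, κL) ↔ sector (N_L, 0),
thermal-to-GS-average LRO, GS-average-to-every-GS (generic-U / Schur, card
generic-u-schur-every-gs)}; SsrBridge ↦ {stiffness ⇒ U(1) condensate at β = κL, B1g selection at t'
= 0}. Lemmas below that ride with --supports.

Rationale: WHY THIS LINE. Superconductivity = charge-2e phase stiffness; its cleanest finite-volume avatar is a
DEFECT FREE ENERGY: the cost of twisting the fermionic boundary data of the torus ('t Hooft's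
twisted partition functions doi:10.1016/0550-3213(79)90595-9; Byers–Yang/Bloch h/2e flux
periodicity; Fisher–Barber–Jasnow helicity modulus doi:10.1103/PhysRevA.8.1111; Pollock–Ceperley
winding formula doi:10.1103/physrevb.36.8343; rigorous for dilute bosons: Lieb–Seiringer–Yngvason
doi:10.1103/physrevb.66.134529). The card's move is to read ALL boundary data — spatial fluxes AND
the temporal spin structure (fermion parity insertion = Matveev–Larkin parity effect
doi:10.1103/physrevlett.78.3749 in partition-function form) — as one function, in the regime β = κL
where (i) positive temperature costs nothing (Koma–Tasaki decay |x|^{−c/β} is invisible at |x| ≤ L,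
KomaTasakiPRL1992), (ii) no ground-state projection, gap or every-GS quantifier enters the flagship
statement, and (iii) the objects are log-RATIOS of partition functions extensive in ONE direction —
the native output of cluster/contour expansions and constructive RG (FrohlichPfisterCMP1981-type
twist free energies; Gaudin1960/BenfattoGiulianiMastropietro2006 for the fermionic determinant
side). Imported areas: lattice gauge/defect free energies (mathematical physics of phase
coexistence), Diophantine analysis of the twisted momentum grid (this session: it dictates the
orbit-summed form of (T)), finite-size SSB theory (KomaTasaki1994, Tasaki2019Tower) for the descent.
Catalogue: operator/partition-function REFORMULATION + physical analogy WITH dictionary (θ ↦ AB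
flux, τ ↦ spin structure, −∂²_θ log Z/(κL) ↦ ρ_s, Z_P/Z_AP ↦ ⟨(−1)^N⟩).
RANKED CRUXES. 2 SsrRigidity — the construction (hardest; a β = κL expansion around a massive BdG
reference must control RATIOS only; why-fail: phase-mode/zero-mode determinants are boundary-data
sensitive at O(log L), vortex pairs of size L weigh L^{−2πκρ_s} so κ₀ matters, and the whole
weak-coupling ceiling applies). 3 SsrBridge — stiffness ⇒ uniform B1g condensate (why-fail: rigid
but B1g-orthogonal condensates — PDW, d_xy below n≈0.6 (RaghuKivelsonScalapino2010 Fig. 2),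
extended-s — and Bose-metal/sliding phases doi:10.1103/physrevb.66.054526; restricted to U>0,
n∈(3/5,1)). 4 SsrThermalToGround — GC Gibbs(κL) LRO ⇒ every sector GS (why-fail: density
plateaus/phase separation at fixed μ; degenerate sector ground spaces invisible to the thermal
mixture; KomaTasaki1994 Conj. 10 direction). Support: SsrFreeParityCollapse (U=0 metal certificate,
provable now from Gaudin's determinant + an elementary lattice-point count: ≥ cL grid momenta within
A/(κL) of the Fermi curve, uniformly in the twist).
CALIBRATION FOUND THIS SESSION (changes the card): for a nodal d_{x²−y²} BdG state the parity ratio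
at a SINGLE spin structure is Π_modes tanh(κL E/2)², and Dirichlet near-hits of the grid on a node
(offset ≲ 1/L infinitely often; super-polynomially small for Liouville node positions) send it to 0
along sparse L — the card's 'bounded at each (θ,P)' and 'universal nodal constants A_j' are false as
stated. The sum over the pair-invisible ORBIT {0,π}² is uniformly bounded below (a node cannot be
within 1/4 spacing of all four half-shifted grids), hence (T). AP ratios (cosh-type) have no such
sensitivity, hence (R1) stands.
KILL CRITERIA. (a) A theorem/certified computation exhibiting, for the attractive or BdG-solvable
calibration, flux rigidity (R1)+(R2) WITHOUT uniform pair-field LRO at β = κL in d = 2 (pair Bose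
metal) kills SsrBridge's mechanism → restate with an explicit condensate hypothesis or close. (b) If
(R2) fails for BCS/BdG d-wave states at θ near (π,0) (paramagnetic nodal backflow beating κρ_sε²L at
the grid scale) → restate R2 with ε-dependent κ₀ or close. (c) ED (4×4, 6×6 full spectra give Z
exactly) showing temporal ORBIT collapse together with flux rigidity in the U<0 s-wave calibration →
drop (T) (split, keep flux half). (d) SsrThermalToGround refuted inside the Hubbard family (thermal
LRO, a sector-GS sequence without LRO) → pivot to GS-average + generic-U.
NOT DECOMPOSED (deliberately): the expansion engine behind SsrRigidity (massive d+id/BdG reference,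
chiral window — shared above-gap input with route WeakCouplingBCS); the free-fermion SPATIAL
non-rigidity calibration (shell arithmetic of E_L(θ), sign-indefinite O(L) log-ratios) and the BdG
flux dictionary (needs pair-momentum branches q ∈ (2π/L)ℤ² of the reference) — both Literature-grade
but number-theoretic; Literature definitions `fluxedOneBody`/`twistedHubbardTorus` (the inline
Matrix.of term, shared with card flux-spectroscopy-klein-bottle) — requested separately, items
restatable verbatim once they land; U<0 s-wave calibration (as hard as attractive-Hubbard SC); the
negative instrument (temporal collapse at (U,δ) ⇒ Fermi surface ⇒ feeds route NoGo).

Novelty: Searched (this session; local searchd was down rc 75 / reset, remote cascade via crossref worked,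
galaxy --star all ran): crossref 'superfluid density winding number path integral Pollock Ceperley'
→ doi:10.1103/physrevb.36.8343 (Z(θ)/Z(0) = characteristic function of the winding number; the
bosonic β∝L^z practice); crossref 'flux quantization two-dimensional Hubbard quantum Monte Carlo
Assaad Hanke Scalapino' → doi:10.1103/physrevlett.71.1915, doi:10.1103/physrevb.50.12835 (h/2e flux
quantisation of F(Φ) at T>0 as SC criterion in Hubbard QMC — the spatial half, numerically);
crossref 'Insulator, metal, or superconductor: the criteria' → doi:10.1103/physrevb.47.7995
(Scalapino–White–Zhang: D vs D_s classifier — nearest 'classifier' prior); crossref 'parity effect …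
Matveev Larkin' → doi:10.1103/physrevlett.78.3749 (temporal half as even/odd free-energy
difference); crossref 'Superfluidity in dilute trapped Bose gases' → doi:10.1103/physrevb.66.134529
(Lieb–Seiringer–Yngvason: twisted-b.c. superfluid density made rigorous, bosons); galaxy --star all
'twisted boundary conditions superfluid density partition function fermions' (0 rows), 'flux
quantization' / 'helicity modulus' (textbooks, BKT volumes, QMC theses only); lit frontier
HubbardSuperconductivity --since 2020 (nothing on twisted Z); plus the card's audited searches ('t
Hooft 1979 doi:10.1016/0550-3213(79)90595-9 twisted-Z phase classification; Byers–Yang;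
Fisher–Barber–Jasnow doi:10.1103/PhysRevA.8.1111; ReadGreen2000  [refs: 10.1103/physrevb.36.8343, 10.1103/physrevlett.71.1915, 10.1103/physrevb.50.12835, 10.1103/physrevb.47.7995, 10.1103/physrevlett.78.3749, 10.1103/physrevb.66.134529, 10.1016/0550-3213(79, 10.1103/PhysRevA.8.1111, doi:10.1103/physrevb.36.8343, doi:10.1103/physrevlett.71.1915, doi:10.1103/physrevb.50.12835, doi:10.1103/physrevb.47.7995, doi:10.1103/physrevlett.78.3749, doi:10.1103/physrevb.66.134529,]

Barriers (technique_class: twisted-partition-function; cluster-expansion; scaling-regime): technique_class: twisted-partition-function; cluster-expansion; scaling-regime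
- Literature.Barriers.HubbardSuperconductivity.PositiveTemperatureNoPairLRO: EVADED by construction
— no Gibbs-state LRO at FIXED β is claimed anywhere; β = κL grows with L, where the
Koma–Tasaki/McBryan–Spencer decay |x|^{−c/β} ≥ L^{−c/(κL)} → 1 carries no information at |x| ≤ L;
SsrBridge's thermal LRO is at β = κL (T = 1/(κL) → 0), outside the theorem's fixed-β hypothesis, and
the flagship objects are free-energy RATIOS, not order parameters.
- Literature.Barriers.HubbardSuperconductivity.HohenbergMerminWagnerPairing: same scope (fixed T > 0
bond pair field); same evasion (β tied to L); nothing at fixed T is asserted.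
- Literature.Barriers.HubbardSuperconductivity.LROForcesLowLyingStates: RESPECTED — the tower of
states/Goldstone modes are exactly what β = κL populates thermally; they enter log-ratios at
O(κ)+O(log L) (recorded as SsrRigidity's why-might-fail), not at the ±cL level of (R2); the every-GS
quantifier is isolated in SsrThermalToGround where the tower is the named difficulty
(Tasaki2019Tower).
- Literature.Barriers.HubbardSuperconductivity.StrongCouplingCeiling: its class (t/U,
high-temperature βt < ε cluster/contour/Pirogov–Sinai expansions from the atomic limit) is NOT the
expansion this route bets on: SsrRigidity wants a WEAK/intermediate-coupling expansion at βt = κL ≫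
1 around a massive paired (BdG, chiral-window) reference whose small parameter is the fermion gap's
decay, and i

Novelty grade: new-combination — Refuter route-review 5e953109, 2026-08-15 (searchd DOWN rc75; galaxy --star all 'flux quantization twisted boundary condition superfluid density fermions parity partition function' 0 rows; crossref x3: 'flux quantization superconducting Hubbard QMC twisted boundary' -> Nakano-Kuroki 2006 PRB 74 1745 (refuter refuter-rreview-route-AnomalousDissipati-5e953109-0, 2026-08-15T14:02:06Z; prior: doi:10.1103/PhysRevLett.7.46 (Byers-Yang 1961 flux quantisation), doi:10.1103/physrevlett.71.1915 (Assaad-Hanke-Scalapino 1993: flux quantisation in Hubbard QMC), doi:10.1103/physrevb.47.7995 (Scalapino-White-Zhang 1993 D vs D_s criteria), doi:10.1103/physrevlett.78.3749 (Matveev-Larkin 1997 parity effect), doi:10.1103/PhysRevB.61.10267 (Read-Green 2000: fermion parity vs spin structure on the tor)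

History (route lifecycle, newest last):
- 2026-08-22T22:26:33Z · DORMANT — reconciler: no traction for 5.7 d (last activity item-evidence-added at 2026-08-17T04:38:37Z); parked, not closed — `ledger route dormant route-HubbardSupercond (operator:999:406506)

sub-problem: HubbardSuperconductivity · status: dormant · opened planner-plancard-HubbardSuperconductivity-Hub-8b27c0f5-0 2026-08-15T10:56:46Z · rev 2 · ledger route-HubbardSuperconductivity-SpinStructureRigidity
GENERATED by the gate from the ledger (D-0016/17). Provers cite these decls: `theorem foo : Summit.HubbardSuperconductivity.HubbardSuperconductivity.Theses.SpinStructureRigidity.<Decl> := …` in Summits/HubbardSuperconductivity/HubbardSuperconductivity/Theorems/<Name>.lean.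
-/

namespace Summit.HubbardSuperconductivity.HubbardSuperconductivity.Theses.SpinStructureRigidity

open scoped BigOperators Topology Manifold Classical MeasureTheory ProbabilityTheory Matrix InnerProductSpace ComplexConjugate ContinuousMap
open Filter Set Function TopologicalSpace MeasureTheory

attribute [summit_statement] _root_.HubbardSuperconductivity

open Literature.Hubbard

/-- item stmt-HubbardSuperconductivity-1488 · crux · rank 2 · open · by planner
why it might fail: Needs a uniformly SC phase of the PURE t'=0 torus with n∈(3/5,1): at U≈6-8 stripes win (no SC at δ≈1/8-1/5: QinEtAl2020, Xu et al. 2024); at weak U the pairing scale e^{-C/U²} is below every convergent expansion (WeakCouplingCeiling); (T) must survive number/phase fluctuations beyond BdG.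
sources: QinEtAl2020, doi:10.1126/science.adh7691, Literature.Barriers.HubbardSuperconductivity.WeakCouplingCeiling, RaghuKivelsonScalapino2010, doi:10.1103/physrevlett.71.1915, doi:10.1103/physrevb.50.12835
[crux] SPIN-STRUCTURE RIGIDITY at beta = kappa*L (card spin-structure-rigidity-beta-kappa-l crux
(3), typed + arithmetic-robust). Dictionary: T_L(theta,mu) = one-body matrix with uniform Peierls
phase e^{i theta_i/L} on each directed bond x->x+e_i (AB flux theta_i through cycle i; theta_i=pi =
antiperiodic spin structure; gauge-equivalent to a seam twist), -mu diagonal; H = dGamma T +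
hubbardTorus 2 L 0 U; Z(theta) = Re tr e^{-kappa L H} (temporal AP); ZP(theta) = Re tr[parityOp
e^{-kappa L H}] (temporal P). CLAIM: some U>0, mu, density n in (3/5,1), kappa0: (D) GC density -> n
at beta=kappa L; and for kappa>=kappa0, eps>0, eventually in even L: (R1) Z(theta)/Z(0) in [e^-C,
e^C] on the pair-invisible fluxes {0,pi}^2 (h/2e quantisation); (R2) Z(theta) <= e^{-cL} Z(0) if
some theta_i is eps-far from pi*Z (twist cost kappa rho_s eps^2 L: charge-2e stiffness as a large
deviation); (T) sum over theta in {0,pi}^2 of |ZP(theta)| >= e^{-C} Z(0) (temporal rigidity of the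
pair-invisible ORBIT; a Fermi surface gives e^{-c'L/kappa}: SsrFreeParityCollapse). Metal violates
R1 (shell energies x kappa L at (pi,0)), R2 (sign-indefinite) and T; a gapped insulator violates R2
(ratio -> 1): the patter -/
@[route_item "route-HubbardSuperconductivity-SpinStructureRigidity", crux]
def SsrRigidity : Prop :=
  ∃ U : ℝ, 0 < U ∧ ∃ μ : ℝ, ∃ n ∈ Set.Ioo (3/5 : ℝ) 1, ∃ κ₀ : ℝ, 0 < κ₀ ∧ (∀ κ : ℝ, κ₀ ≤ κ → Filter.Tendsto (fun L : ℕ => ((Literature.MathematicalPhysics.QuantumLattice.hubbardTorusWith 2 (L + 1) 1 U μ).gibbsState (κ * ((L + 1 : ℕ) : ℝ)) Literature.MathematicalPhysics.QuantumLattice.totalNumber).re / ((L + 1 : ℕ) : ℝ) ^ 2) Filter.atTop (nhds n)) ∧ (∀ κ : ℝ, κ₀ ≤ κ → ∀ ε : ℝ, 0 < ε → ∃ C c : ℝ, 0 < c ∧ ∃ L₀ : ℕ, ∀ (L : ℕ) [NeZero L], Even L → L₀ ≤ L → let H : (Fin 2 → ℝ) → Matrix (Finset (Literature.MathematicalPhysics.QuantumLattice.Orb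 (Literature.MathematicalPhysics.QuantumLattice.FermionTorus 2 L))) (Finset (Literature.MathematicalPhysics.QuantumLattice.Orb (Literature.MathematicalPhysics.QuantumLattice.FermionTorus 2 L))) ℂ := (fun θ : Fin 2 → ℝ => Literature.MathematicalPhysics.QuantumLattice.dGamma (Matrix.of fun o o' : Literature.MathematicalPhysics.QuantumLattice.Orb (Literature.MathematicalPhysics.QuantumLattice.FermionTorus 2 L) => (if (ofLex o).2 = (ofLex o').2 then ∑ i : Fin 2, ((if ofLex (ofLex o).1 = Function.update (ofLex (ofLex o').1) i (ofLex (ofLex o').1 i + 1) then -Complex.exp (Complex.I * ((θ i : ℝ) : ℂ) / (L : ℂ)) else 0) + (if ofLex (ofLex o').1 = Function.update (ofLex (ofLex o).1) i (ofLex (ofLex o).1 i + 1) then -Complex.exp (-(Complex.I * ((θ i : ℝ) : ℂ) / (L : ℂ))) else 0)) else 0) - (if o = o' then ((μ : ℝ) : ℂ) else 0)) + Literature.MathematicalPhysics.QuantumLattice.hubbardTorus 2 L 0 U); let Z : (Fin 2 → ℝ) → ℝ := fun θ => ((H θ).partitionFn (κ * L)).re; let ZP : (Fin 2 → ℝ)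 → ℝ := fun θ => (Literature.MathematicalPhysics.QuantumLattice.parityOp * (H θ).gibbsWeight (κ * L)).trace.re; (∀ θ : Fin 2 → ℝ, (∀ i, θ i = 0 ∨ θ i = Real.pi) → Real.exp (-C) * Z 0 ≤ Z θ ∧ Z θ ≤ Real.exp C * Z 0) ∧ (∀ θ : Fin 2 → ℝ, (∃ i, ∀ m : ℤ, ε ≤ |θ i - m * Real.pi|) → Z θ ≤ Real.exp (-(c * L)) * Z 0) ∧ Real.exp (-C) * Z 0 ≤ |ZP (fun _ => 0)| + |ZP (fun i => if i = 0 then Real.pi else 0)| + |ZP (fun i => if i = 0 then 0 else Real.pi)| + |ZP (fun _ => Real.pi)|)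

/-- item stmt-HubbardSuperconductivity-1489 · crux · rank 3 · open · by planner
why it might fail: (R1)+(R2) are blind to pairing symmetry: any charge-2e condensate is flux-rigid. The ∀U>0,∀n∈(3/5,1) box contains the weak-coupling corner n≈0.6⁺, U<0.08 where p^(6)/d_xy, not d_{x²-y²}, lead (RKS2010 boundary 'about n=0.6'; Šimkovic et al. 2016 §3.1) ⇒ ⟨Δ_d†Δ_d⟩/L⁴→0; PDW/4e likewise.
sources: RaghuKivelsonScalapino2010, arXiv:1512.04271, doi:10.1103/physrevb.94.085106, doi:10.1103/physrevb.66.054526, doi:10.1103/physrevb.47.7995, LiebSeiringerYngvason2002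
[crux] THE NAMED CONDITIONAL BRIDGE: flux rigidity => thermal d-wave pair-field LRO at beta = kappa
L. CLAIM: for all U>0, mu, kappa0>0 and n in (3/5,1): if the Gibbs density of hubbardTorusWith 2 L 1
U mu at beta = kappa L tends to n (all kappa >= kappa0) and the FLUX HALF (R1)+(R2) of SsrRigidity
holds (same inline objects, verbatim), then for every kappa >= kappa0 there are c>0, L0 with c L^4
<= Re gibbsState (kappa L) (hubbardTorusWith 2 L 1 U mu) ((pairField dWaveFormFactor L)^H *
pairField dWaveFormFactor L) for all even L >= L0 (pairField d L = sqrt 2 Delta_d, the summit's own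
operator). Content: (i) identify H_L(0;U,mu) with hubbardTorusWith 2 L 1 U mu (L >= 3, routine);
(ii) stiffness => U(1) condensate: the helicity modulus rho_s > 0 read off (R2) (-(kappa L)^{-1} log
Z(theta)/Z(0) ~ rho_s dist(2 theta, 2 pi Z)^2/8) must force off-diagonal order of the charge-2e
field at scale L when T = 1/(kappa L) -> 0 — the finite-volume, beta = kappa L twin of 'superfluid
density > 0 => BEC', which is NOT a theorem in general (1D/BKT counter-directions;
Lieb-Seiringer-Yngvason 2002 prove both separately for dilute bosons); (iii) B1g SELECTION: in the
pure repulsive model at density n -/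
@[route_item "route-HubbardSuperconductivity-SpinStructureRigidity", crux]
def SsrBridge : Prop :=
  ∀ (U μ κ₀ n : ℝ), 0 < U → 0 < κ₀ → n ∈ Set.Ioo (3/5 : ℝ) 1 → (∀ κ : ℝ, κ₀ ≤ κ → Filter.Tendsto (fun L : ℕ => ((Literature.MathematicalPhysics.QuantumLattice.hubbardTorusWith 2 (L + 1) 1 U μ).gibbsState (κ * ((L + 1 : ℕ) : ℝ)) Literature.MathematicalPhysics.QuantumLattice.totalNumber).re / ((L + 1 : ℕ) : ℝ) ^ 2) Filter.atTop (nhds n)) → (∀ κ : ℝ, κ₀ ≤ κ → ∀ ε : ℝ, 0 < ε → ∃ C c : ℝ, 0 < c ∧ ∃ L₀ : ℕ, ∀ (L : ℕ) [NeZero L], Even L → L₀ ≤ L → let H : (Fin 2 → ℝ) → Matrix (Finset (Literature.MathematicalPhysics.QuantumLattice.Orb (Literature.MathematicalPhysics.QuantumLattice.FermionTorus 2 L))) (Finset (Literature.MathematicalPhysics.QuantumLattice.Orb (Literature.MathematicalPhysics.QuantumLattice.FermionTorus 2 L))) ℂ := (fun θ : Fin 2 → ℝ => Literature.MathematicalPhysics.QuantumLattice.dGamma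 (Matrix.of fun o o' : Literature.MathematicalPhysics.QuantumLattice.Orb (Literature.MathematicalPhysics.QuantumLattice.FermionTorus 2 L) => (if (ofLex o).2 = (ofLex o').2 then ∑ i : Fin 2, ((if ofLex (ofLex o).1 = Function.update (ofLex (ofLex o').1) i (ofLex (ofLex o').1 i + 1) then -Complex.exp (Complex.I * ((θ i : ℝ) : ℂ) / (L : ℂ)) else 0) + (if ofLex (ofLex o').1 = Function.update (ofLex (ofLex o).1) i (ofLex (ofLex o).1 i + 1) then -Complex.exp (-(Complex.I * ((θ i : ℝ) : ℂ) / (L : ℂ))) else 0)) else 0) - (if o = o' then ((μ : ℝ) : ℂ) else 0)) + Literature.MathematicalPhysics.QuantumLattice.hubbardTorus 2 L 0 U); let Z : (Fin 2 → ℝ) → ℝ := fun θ => ((H θ).partitionFn (κ * L)).re; (∀ θ : Fin 2 → ℝ, (∀ i, θ i = 0 ∨ θ i = Real.pi) → Real.exp (-C) * Z 0 ≤ Z θ ∧ Z θ ≤ Real.exp C * Z 0) ∧ (∀ θ : Fin 2 → ℝ, (∃ i, ∀ m : ℤ, ε ≤ |θ i - m * Real.pi|) → Z θ ≤ Real.exp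 (-(c * L)) * Z 0)) → (∀ κ : ℝ, κ₀ ≤ κ → ∃ c : ℝ, 0 < c ∧ ∃ L₀ : ℕ, ∀ (L : ℕ) [NeZero L], Even L → L₀ ≤ L → c * (L : ℝ) ^ 4 ≤ ((Literature.MathematicalPhysics.QuantumLattice.hubbardTorusWith 2 L 1 U μ).gibbsState (κ * L) ((Literature.MathematicalPhysics.QuantumLattice.pairField Literature.MathematicalPhysics.QuantumLattice.dWaveFormFactor L)ᴴ * Literature.MathematicalPhysics.QuantumLattice.pairField Literature.MathematicalPhysics.QuantumLattice.dWaveFormFactor L)).re)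

/-- item stmt-HubbardSuperconductivity-1490 · crux · rank 4 · open · by planner
why it might fail: c(κ)>0 is given per κ with no uniformity, so c(κ)→0 is allowed and even GS-average LRO does not follow formally (L→∞ before κ→∞); a degenerate (N_L,S^z=0) ground space can hide an LRO-free ground state from the Gibbs mixture; fixed μ may sit on a phase-separation density jump (GC(μ) ≠ sector N_L).
sources: KomaTasaki1994, Tasaki2019Tower, Literature.Barriers.HubbardSuperconductivity.LROForcesLowLyingStates, ArovasBergKivelsonRaghu2022, LiebPRL1989
[crux] DESCENT beta = kappa L -> ground states (card item (4) 'ThermalToGround', honestly a crux).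
CLAIM: for all U>0, mu, kappa0>0, n in (3/5,1): GC density -> n at beta = kappa L (all kappa >=
kappa0) and thermal d-wave pair-field LRO >= c(kappa) L^4 of gibbsState (kappa L) (hubbardTorusWith
2 L 1 U mu) for all kappa >= kappa0 (eventually in even L) imply
Literature.Barriers.HubbardSuperconductivity.HasDWavePairFieldLROAt U (1-n): EVERY normalised (N_L,
S^z=0)-sector ground-state sequence of hubbardTorus 2 L 1 U, N_L = 2 floor(n L^2/2), has d-wave
pair-field LRO along even L (the summit's matrix at fixed (U, delta = 1-n); summit = exists U>0,
delta in (0,1/2), HasDWavePairFieldLROAt U delta by Iff.rfl, glue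
hubbardSuperconductivity_of_evenThesis_half already in Theorems/WeakCouplingBCSWcbcsThesis.lean).
Three sub-steps (the intended split, <= 3 children): (a) ensemble equivalence GC(mu, kappa L) <->
canonical (N_L, S^z=0) using the density clause and SU(2) (S^z=0 sector contains a GS of every S
multiplet); (b) thermal LRO for all large kappa => LRO of the tracial ground-state functional of the
sector (kappa -> infinity AFTER the liminf in L is the delicate order: use the free-ene -/
@[route_item "route-HubbardSuperconductivity-SpinStructureRigidity", crux]
def SsrThermalToGround : Prop :=
  ∀ (U μ κ₀ n : ℝ), 0 < U → 0 < κ₀ → n ∈ Set.Ioo (3/5 : ℝ) 1 → (∀ κ : ℝ, κ₀ ≤ κ → Filter.Tendsto (fun L : ℕ => ((Literature.MathematicalPhysics.QuantumLattice.hubbardTorusWith 2 (L + 1) 1 U μ).gibbsState (κ * ((L + 1 : ℕ) : ℝ)) Literature.MathematicalPhysics.QuantumLattice.totalNumber).re / ((L + 1 : ℕ) : ℝ) ^ 2) Filter.atTop (nhds n)) → (∀ κ : ℝ, κ₀ ≤ κ → ∃ c : ℝ, 0 < c ∧ ∃ L₀ : ℕ, ∀ (L : ℕ) [NeZero L], Even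 L → L₀ ≤ L → c * (L : ℝ) ^ 4 ≤ ((Literature.MathematicalPhysics.QuantumLattice.hubbardTorusWith 2 L 1 U μ).gibbsState (κ * L) ((Literature.MathematicalPhysics.QuantumLattice.pairField Literature.MathematicalPhysics.QuantumLattice.dWaveFormFactor L)ᴴ * Literature.MathematicalPhysics.QuantumLattice.pairField Literature.MathematicalPhysics.QuantumLattice.dWaveFormFactor L)).re) → Literature.Barriers.HubbardSuperconductivity.HasDWavePairFieldLROAt U (1 - n)

/-- item stmt-HubbardSuperconductivity-1491 · support · rank 9 · closed · proved by Summit.HubbardSuperconductivity.HubbardSuperconductivity.Theorems.SpinStructureRigidity.ssrFreeParityCollapse_proof @ f90bf8c23c4f (prover) · by planner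
why it might fail: Provable now at U=0: ratio = Π_k tanh(κLξ_k/2)² and ≥ c'L grid momenta lie within 8πκ/(κL) of the Fermi curve uniformly in the twist (annulus k-width ≥ 2√2π/L > grid-cell diameter); only bookkeeping risk (small L, band edges μ=±4 excluded).
sources: Gaudin1960, doi:10.1103/physrevlett.78.3749, doi:10.1103/physrevb.47.7995, BenfattoGiulianiMastropietro2006
[support] FREE-FERMION TEMPORAL COLLAPSE = Fermi-surface certificate (card calibration (2a);
Literature-grade, PROVABLE NOW). U = 0, mu in (-4,4) (inside the band), kappa > 0: exists c>0, L0
s.t. for all L >= L0 and EVERY flux theta: |Re tr[parityOp e^{-kappa L dGamma(T_L(theta,mu))}]| <=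
e^{-cL} Re tr e^{-kappa L dGamma(T_L(theta,mu))}. Proof sketch: plane waves on the theta/L-shifted
grid diagonalise T_L (cf. hubbardOneBody_mulVec_planeWave, torusBand); tr e^{-beta dGamma(h)} =
prod_k (1+e^{-beta xi_k})^2 and, since parityOp = e^{i pi N} commutes, tr[P e^{-beta dGamma h}] =
prod_k (1-e^{-beta xi_k})^2, so the ratio is prod_k tanh(beta xi_k/2)^2 in [0,1]; it remains to find
>= c' L grid momenta with |xi_k| <= A/(kappa L): the annulus {|eps(k)-mu| <= A/(kappa L)} has
k-width >= A/(2 sqrt 2 kappa L) >= 2 sqrt 2 pi/L for A = 8 pi kappa, so it contains >= c'' L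
disjoint discs of radius (sqrt 2/2)(2 pi/L), each holding a grid point, uniformly in the shift
theta/L (elementary; no lattice-point asymptotics needed); each such k contributes a factor
tanh(A/2)^2 < 1. Role: calibrates (T) of SsrRigidity (a metal violates it at all four pair-invisible
spin structures) and is the NEGATIVE INST -/
@[route_item "route-HubbardSuperconductivity-SpinStructureRigidity"]
def SsrFreeParityCollapse : Prop :=
  ∀ μ ∈ Set.Ioo (-4 : ℝ) 4, ∀ κ : ℝ, 0 < κ → ∃ c : ℝ, 0 < c ∧ ∃ L₀ : ℕ, ∀ (L : ℕ) [NeZero L], L₀ ≤ L → let H : (Fin 2 → ℝ) → Matrix (Finset (Literature.MathematicalPhysics.QuantumLattice.Orb (Literature.MathematicalPhysics.QuantumLattice.FermionTorus 2 L))) (Finset (Literature.MathematicalPhysics.QuantumLattice.Orb (Literature.MathematicalPhysics.QuantumLattice.FermionTorus 2 L))) ℂ := (fun θ : Fin 2 → ℝ => Literature.MathematicalPhysics.QuantumLattice.dGamma (Matrix.of fun o o' : Literature.MathematicalPhysics.QuantumLattice.Orb (Literature.MathematicalPhysics.QuantumLattice.FermionTorus 2 L) => (if (ofLex o).2 = (ofLex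 o').2 then ∑ i : Fin 2, ((if ofLex (ofLex o).1 = Function.update (ofLex (ofLex o').1) i (ofLex (ofLex o').1 i + 1) then -Complex.exp (Complex.I * ((θ i : ℝ) : ℂ) / (L : ℂ)) else 0) + (if ofLex (ofLex o').1 = Function.update (ofLex (ofLex o).1) i (ofLex (ofLex o).1 i + 1) then -Complex.exp (-(Complex.I * ((θ i : ℝ) : ℂ) / (L : ℂ))) else 0)) else 0) - (if o = o' then ((μ : ℝ) : ℂ) else 0))); let Z : (Fin 2 → ℝ) → ℝ := fun θ => ((H θ).partitionFn (κ * L)).re; let ZP : (Fin 2 → ℝ) → ℝ := fun θ => (Literature.MathematicalPhysics.QuantumLattice.parityOp * (H θ).gibbsWeight (κ * L)).trace.re; ∀ θ : Fin 2 → ℝ, |ZP θ| ≤ Real.exp (-(c * L)) * Z θ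

/-- item stmt-HubbardSuperconductivity-1492 · assembly · rank 1 · closed · proved by Summit.HubbardSuperconductivity.HubbardSuperconductivity.Theorems.spinStructureRigidity_assembly_proof (prover) · by planner
sources: Scalapino1995, ArovasBergKivelsonRaghu2022
[assembly] SsrRigidity -> SsrBridge -> SsrThermalToGround -> HubbardSuperconductivity. PURE LOGIC
(proved rc0 in the planner's Sketch.lean, 8 lines): take (U, mu, n, kappa0) from SsrRigidity,
project its pattern to the flux half (R1)+(R2) (the let-bound objects are verbatim the same), feed
SsrBridge then SsrThermalToGround to get HasDWavePairFieldLROAt U (1-n), and close with delta := 1-n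
in (0, 2/5) subset (0, 1/2) (two linariths) after unfolding HubbardSuperconductivity /
DWaveSuperconductivityHubbard. -/
@[route_item "route-HubbardSuperconductivity-SpinStructureRigidity"]
def Assembly : Prop :=
  SsrRigidity → SsrBridge → SsrThermalToGround → HubbardSuperconductivity

/-! D-0027 §2.1 — DECIDING THEOREM (planner-authored via `route open/edit --closes-file`; by planner-rbadge-HubbardSuperconductivity-SpinSt-778b9cd5-g2-0 2026-08-15T16:23:16Z):
its hypotheses are this route's items and its conclusion the sub-problem Statement (glue_lint), and it elaborates with this file. -/

@[closes "route-HubbardSuperconductivity-SpinStructureRigidity"] theorem closes (h₁ : SsrRigidity) (h₂ : SsrBridge) (h₃ : SsrThermalToGround) :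
    _root_.HubbardSuperconductivity := by
  obtain ⟨U, hU, μ, n, hn, κ₀, hκ₀, hdens, hrig⟩ := h₁
  have hGS : Literature.Barriers.HubbardSuperconductivity.HasDWavePairFieldLROAt U (1 - n) := by
    refine h₃ U μ κ₀ n hU hκ₀ hn hdens (h₂ U μ κ₀ n hU hκ₀ hn hdens ?_)
    intro κ hκ ε hε
    obtain ⟨C, c, hc, L₀, hL⟩ := hrig κ hκ ε hε
    refine ⟨C, c, hc, L₀, ?_⟩
    intro L hLne hE hL₀
    have h := @hL L hLne hE hL₀
    exact ⟨h.1, h.2.1⟩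
  unfold _root_.HubbardSuperconductivity Literature.Hubbard.DWaveSuperconductivityHubbard
  exact ⟨U, hU, 1 - n, ⟨by linarith [hn.2], by linarith [hn.1]⟩, hGS⟩

end Summit.HubbardSuperconductivity.HubbardSuperconductivity.Theses.SpinStructureRigidity
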